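import Summits.Ventures.PercRepro.Night2ThreeTwoTypeFaces

/-!
# PercRepro — the cell `(3, 2)`: the per-basis loss bound by the position of the basis on the line (night-2, gen 26)

`Night2ThreeTwoTypeFaces` gives the face structure of a covering basis `K ∪ T` with `t = |T ∩ ℓ| ≤ 1` points on the
common line: at most one face contains `ℓ`, every other face misses `≥ |ℓ| − 1` points, and `Σ_w m_w ≥ 3 n − y − 7 + t`.
With per-face chords `1/(m + 3) ≤ a₀ − b₀ m` (the `ℓ`-face, `2 ≤ m ≤ n − 3`) and `1/(m + 3) ≤ a₁ − b₁ m` (the others,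
`n − y − 1 ≤ m ≤ n − 3`) the loss `L1 − capS ≤ Φ Σ_w 1/(m_w + 3) − 5/12` is at most
`typeBound n y t a₀ b₀ a₁ b₁ = Φ (4 a₁ − b₁ (3 n − y − 7 + t) + max 0 ((a₀ − a₁) − 2 (b₀ − b₁))) − 5/12`.

* `card_face_ge_of_not_subset`: a face not containing `ℓ` misses `≥ |ℓ| − 1` points;
* `sum_inv_faces_le_of_line`: the reciprocal face sum under the chords;
* **`faceLoss_sum_le_of_line`**: the face losses of such a basis sum to at most `max 0 (typeBound …)`;
* **`faceLoss_sum_le_eleven`**: at `n = 11`, `3 ≤ y ≤ 6`: at most `typeConst t y` (`t = 1`: `103/660`, `337/1980`,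
  `31/165`, `139/660`; `t = 0`: `1/6`, `1081/5940`, `177/880`, `149/660` for `y = 3, 4, 5, 6`; chords `[2, 8]` and
  `[10 − y, 8]`).
-/

namespace PercRepro.Shadow

open Finset PerFlat ThmH

variable {α : Type*} [DecidableEq α] {M : Matroid α} [M.Finite]

section TypeLoss

variable {G : Finset α}

open scoped Classical in
/-- A face not containing the line misses at least `|ℓ| − 1` points of `G`. -/
theorem card_face_ge_of_not_subset {ℓ : Finset α} (hℓV : ℓ ⊆ G \ coloops M G)
    (hs : ∀ e ∈ gr M, ∀ f ∈ gr M, e ≠ f → rkN M {e, f} = 2) (hℓg : ℓ ⊆ gr M) (hℓr : rkN M ℓ ≤ 2)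
    {Q : Finset α} {w : α} (hF : ¬ ℓ ⊆ clF M (Q.erase w)) :
    ℓ.card ≤ (G \ clF M (Q.erase w)).card + 1 := by
  have h1 := card_inter_clF_le_one_of_not_subset hs hℓg hℓr hF
  have h2 : ℓ \ clF M (Q.erase w) ⊆ G \ clF M (Q.erase w) :=
    Finset.sdiff_subset_sdiff (fun a ha => (Finset.mem_sdiff.1 (hℓV ha)).1) (Finset.Subset.refl _)
  have h3 := Finset.card_le_card h2
  have h4 := Finset.card_sdiff_add_card_inter ℓ (clF M (Q.erase w))
  omega

/-- The per-type bound on the loss of a covering basis with `t ≤ 1` points on the line, from per-face chords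
`1/(m + 3) ≤ a₀ − b₀ m` (the `ℓ`-face, `2 ≤ m ≤ n − 3`) and `1/(m + 3) ≤ a₁ − b₁ m` (the other faces,
`n − y − 1 ≤ m ≤ n − 3`): `Φ (4 a₁ − b₁ (3 n − y − 7 + t) + max 0 ((a₀ − a₁) − 2 (b₀ − b₁))) − 5/12`. -/
def typeBound (n y t : ℕ) (a₀ b₀ a₁ b₁ : ℚ) : ℚ :=
  phiQ 5 * (4 * a₁ - b₁ * (3 * (n : ℚ) - (y : ℚ) - 7 + (t : ℚ)) + max 0 ((a₀ - a₁) - 2 * (b₀ - b₁))) - 5 / 12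

open scoped Classical in
/-- **The face sum of reciprocals under the chords.** -/
theorem sum_inv_faces_le_of_line (hG : G ∈ flatsQ M (5 + 1)) (hk : kColoops M G = 2)
    (hs : ∀ e ∈ gr M, ∀ f ∈ gr M, e ≠ f → rkN M {e, f} = 2) (hl : ∀ e ∈ gr M, M.Indep {e})
    {ℓ : Finset α} (hℓr : rkN M ℓ ≤ 2) (hℓ2 : 2 ≤ ℓ.card) (hℓV : ℓ ⊆ G \ coloops M G)
    (hℓcl : ∀ x ∈ G \ coloops M G, x ∈ clF M ℓ → x ∈ ℓ)
    {Q : Finset α} (hQ : Q ∈ shadowAt M (5 + 2) 5 (Uq M (5 + 2) 5) G) (hQc : (Q \ coloops M G).card = 4)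
    (ht : ((Q \ coloops M G) ∩ ℓ).card ≤ 1)
    {a₀ b₀ a₁ b₁ : ℚ} (hb : b₁ ≤ b₀) (hb1 : 0 ≤ b₁)
    (hch0 : ∀ m : ℕ, 2 ≤ m → m ≤ (G \ coloops M G).card - 3 → 1 / ((m : ℚ) + 3) ≤ a₀ - b₀ * (m : ℚ))
    (hch1 : ∀ m : ℕ, 2 ≤ m → (G \ coloops M G).card - ((G \ coloops M G) \ ℓ).card - 1 ≤ m →
      m ≤ (G \ coloops M G).card - 3 → 1 / ((m : ℚ) + 3) ≤ a₁ - b₁ * (m : ℚ)) :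
    ∑ w ∈ Q \ coloops M G, 1 / (((G \ clF M (Q.erase w)).card : ℚ) + 3) ≤
      4 * a₁ - b₁ * (3 * ((G \ coloops M G).card : ℚ) - (((G \ coloops M G) \ ℓ).card : ℚ) - 7 +
        (((Q \ coloops M G) ∩ ℓ).card : ℚ)) + max 0 ((a₀ - a₁) - 2 * (b₀ - b₁)) := by
  have hk' : kColoops M G + 4 = 5 + 1 := by omega
  have hGg : G ⊆ gr M := (mem_flatsQ.1 hG).1
  have hℓg : ℓ ⊆ gr M := fun a ha => hGg (Finset.mem_sdiff.1 (hℓV ha)).1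
  set T := Q \ coloops M G with hT
  set n := (G \ coloops M G).card with hn
  set y := ((G \ coloops M G) \ ℓ).card with hy
  have hnQ : (G \ Q).card + 4 = n := card_sdiff_add_eq_of_mem_shadowAt hQ hQc
  -- the range of every face
  have hlo : ∀ w ∈ T, 2 ≤ (G \ clF M (Q.erase w)).card := fun w hw => two_le_card_face hk' hQ hQc hw
  have hhi : ∀ w ∈ T, (G \ clF M (Q.erase w)).card ≤ n - 3 := by
    intro w _
    have := card_face_le hG hQ (w := w)
    omega
  -- per-face bound
  have hface : ∀ w ∈ T, 1 / (((G \ clF M (Q.erase w)).card : ℚ) + 3) ≤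
      (a₁ - b₁ * ((G \ clF M (Q.erase w)).card : ℚ)) +
        (if ℓ ⊆ clF M (Q.erase w) then (a₀ - a₁) - 2 * (b₀ - b₁) else 0) := by
    intro w hw
    split_ifs with hsub
    · have h0 := hch0 _ (hlo w hw) (hhi w hw)
      have hm2 : (2 : ℚ) ≤ ((G \ clF M (Q.erase w)).card : ℚ) := by exact_mod_cast hlo w hw
      nlinarith [sub_nonneg.2 hb, h0, hm2]
    · rw [add_zero]
      have hlo1 := card_face_ge_of_not_subset hℓV hs hℓg hℓr hsub
      have hℓn : ℓ.card = n - y := by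
        rw [hy, Finset.card_sdiff_of_subset hℓV]
        have := Finset.card_le_card hℓV
        omega
      exact hch1 _ (hlo w hw) (by omega) (hhi w hw)
  have hfilt : (T.filter (fun w => ℓ ⊆ clF M (Q.erase w))).card ≤ 1 := by
    rw [Finset.card_le_one]
    intro w hw w' hw'
    rw [Finset.mem_filter] at hw hw'
    by_contra hne
    exact not_subset_both_faces hG hk hs hℓ2 hℓV hℓcl hQ hQc ht hw.1 hw'.1 hne hw.2 hw'.2
  have hsumfaces := sum_faces_ge_of_line hG hk hs hl hℓr hℓ2 hℓV hℓcl hQ hQc ht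
  have hsumQ : (3 * n + (T ∩ ℓ).card : ℚ) ≤ (y : ℚ) + 7 + ∑ w ∈ T, ((G \ clF M (Q.erase w)).card : ℚ) := by
    have h := hsumfaces
    rw [← hn, ← hy] at h
    exact_mod_cast h
  calc ∑ w ∈ T, 1 / (((G \ clF M (Q.erase w)).card : ℚ) + 3)
      ≤ ∑ w ∈ T, ((a₁ - b₁ * ((G \ clF M (Q.erase w)).card : ℚ)) +
          (if ℓ ⊆ clF M (Q.erase w) then (a₀ - a₁) - 2 * (b₀ - b₁) else 0)) := Finset.sum_le_sum hface
    _ = (4 * a₁ - b₁ * ∑ w ∈ T, ((G \ clF M (Q.erase w)).card : ℚ)) +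
          (T.filter (fun w => ℓ ⊆ clF M (Q.erase w))).card * ((a₀ - a₁) - 2 * (b₀ - b₁)) := by
        rw [Finset.sum_add_distrib, Finset.sum_ite, Finset.sum_const, Finset.sum_const_zero, add_zero,
          Finset.sum_sub_distrib, Finset.sum_const, hQc, Finset.mul_sum, nsmul_eq_mul, nsmul_eq_mul]
        push_cast
        ring
    _ ≤ (4 * a₁ - b₁ * (3 * (n : ℚ) - (y : ℚ) - 7 + ((T ∩ ℓ).card : ℚ))) + max 0 ((a₀ - a₁) - 2 * (b₀ - b₁)) := by
        have hc : ((T.filter (fun w => ℓ ⊆ clF M (Q.erase w))).card : ℚ) ≤ 1 := by exact_mod_cast hfilt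
        have hc0 : (0 : ℚ) ≤ ((T.filter (fun w => ℓ ⊆ clF M (Q.erase w))).card : ℚ) := by positivity
        have hmax1 : (a₀ - a₁) - 2 * (b₀ - b₁) ≤ max 0 ((a₀ - a₁) - 2 * (b₀ - b₁)) := le_max_right _ _
        have hmax0 : (0 : ℚ) ≤ max 0 ((a₀ - a₁) - 2 * (b₀ - b₁)) := le_max_left _ _
        have h1 : ((T.filter (fun w => ℓ ⊆ clF M (Q.erase w))).card : ℚ) * ((a₀ - a₁) - 2 * (b₀ - b₁)) ≤
            max 0 ((a₀ - a₁) - 2 * (b₀ - b₁)) := by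
          rcases le_or_gt 0 ((a₀ - a₁) - 2 * (b₀ - b₁)) with hpos | hneg
          · calc ((T.filter (fun w => ℓ ⊆ clF M (Q.erase w))).card : ℚ) * ((a₀ - a₁) - 2 * (b₀ - b₁))
                ≤ 1 * ((a₀ - a₁) - 2 * (b₀ - b₁)) := mul_le_mul_of_nonneg_right hc hpos
              _ ≤ max 0 ((a₀ - a₁) - 2 * (b₀ - b₁)) := by rw [one_mul]; exact hmax1
          · calc ((T.filter (fun w => ℓ ⊆ clF M (Q.erase w))).card : ℚ) * ((a₀ - a₁) - 2 * (b₀ - b₁)) ≤ 0 :=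
                mul_nonpos_of_nonneg_of_nonpos hc0 hneg.le
              _ ≤ max 0 ((a₀ - a₁) - 2 * (b₀ - b₁)) := hmax0
        have h2 : b₁ * (3 * (n : ℚ) - (y : ℚ) - 7 + ((T ∩ ℓ).card : ℚ)) ≤
            b₁ * ∑ w ∈ T, ((G \ clF M (Q.erase w)).card : ℚ) := by
          apply mul_le_mul_of_nonneg_left _ hb1
          linarith
        linarith

open scoped Classical in
/-- **THE TYPE-SPLIT PER-BASIS LOSS BOUND**: the face losses of a covering basis `K ∪ T` of a target, with `t ≤ 1`
points of `T` on the line `ℓ`, sum to at most `max 0 (typeBound n y t a₀ b₀ a₁ b₁)` under the per-face chords. -/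
theorem faceLoss_sum_le_of_line (hG : G ∈ flatsQ M (5 + 1)) (hd : (gr M \ G).card = 3) (hk : kColoops M G = 2)
    (hs : ∀ e ∈ gr M, ∀ f ∈ gr M, e ≠ f → rkN M {e, f} = 2) (hl : ∀ e ∈ gr M, M.Indep {e})
    {ℓ : Finset α} (hℓr : rkN M ℓ ≤ 2) (hℓ2 : 2 ≤ ℓ.card) (hℓV : ℓ ⊆ G \ coloops M G)
    (hℓcl : ∀ x ∈ G \ coloops M G, x ∈ clF M ℓ → x ∈ ℓ)
    {S T : Finset α} (hT : T ∈ coverBases M G S 4) (ht : (T ∩ ℓ).card ≤ 1)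
    {a₀ b₀ a₁ b₁ : ℚ} (hb : b₁ ≤ b₀) (hb1 : 0 ≤ b₁)
    (hch0 : ∀ m : ℕ, 2 ≤ m → m ≤ (G \ coloops M G).card - 3 → 1 / ((m : ℚ) + 3) ≤ a₀ - b₀ * (m : ℚ))
    (hch1 : ∀ m : ℕ, 2 ≤ m → (G \ coloops M G).card - ((G \ coloops M G) \ ℓ).card - 1 ≤ m →
      m ≤ (G \ coloops M G).card - 3 → 1 / ((m : ℚ) + 3) ≤ a₁ - b₁ * (m : ℚ)) :
    ∑ w ∈ T, faceLoss M 5 G (coloops M G ∪ T) w ≤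
      max 0 (typeBound (G \ coloops M G).card ((G \ coloops M G) \ ℓ).card (T ∩ ℓ).card a₀ b₀ a₁ b₁) := by
  have hd' : (gr M \ G).card ≤ 5 := by omega
  have hk' : kColoops M G + 4 = 5 + 1 := by omega
  have hT' : T ∈ (S \ coloops M G).powersetCard 4 := (Finset.mem_filter.1 hT).1
  rw [Finset.mem_powersetCard] at hT'
  obtain ⟨hTS, hTc⟩ := hT'
  have hTK : Disjoint (coloops M G) T := by
    rw [Finset.disjoint_left]
    intro x hx hxT
    exact (Finset.mem_sdiff.1 (hTS hxT)).2 hx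
  have hQT : (coloops M G ∪ T) \ coloops M G = T := Finset.union_sdiff_cancel_left hTK
  have hmax0 : (0 : ℚ) ≤ max 0 (typeBound (G \ coloops M G).card ((G \ coloops M G) \ ℓ).card (T ∩ ℓ).card a₀ b₀ a₁ b₁) :=
    le_max_left _ _
  by_cases hQ : coloops M G ∪ T ∈ shadowAt M (5 + 2) 5 (Uq M (5 + 2) 5) G
  · have hQc : ((coloops M G ∪ T) \ coloops M G).card = 4 := by rw [hQT, hTc]
    have hQG : coloops M G ∪ T ⊆ G := subset_G_of_mem_shadowAt hQ
    have hcap : 0 ≤ capS M 5 G (coloops M G ∪ T) := capS_nonneg' hG hd' _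
    have hcap5 : 5 / 12 ≤ capS M 5 G (coloops M G ∪ T) := capS_ge_five_twelfths_three_two hd hk hQG
    have hsum := sum_inv_faces_le_of_line hG hk hs hl hℓr hℓ2 hℓV hℓcl hQ hQc (by rw [hQT]; exact ht) hb hb1 hch0 hch1
    rw [hQT] at hsum
    have hL1 : L1 M 5 G (coloops M G ∪ T) ≤ phiQ 5 * ∑ w ∈ T, 1 / (((G \ clF M ((coloops M G ∪ T).erase w)).card : ℚ) + 3) := by
      have := L1_le_sum_faces hG hd (by norm_num) (by norm_num) hQ
      rw [hQT] at this
      exact_mod_cast this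
    have hΦ : phiQ 5 = 7 / 6 := by unfold phiQ; norm_num
    calc ∑ w ∈ T, faceLoss M 5 G (coloops M G ∪ T) w
        = ∑ w ∈ (coloops M G ∪ T) \ coloops M G, faceLoss M 5 G (coloops M G ∪ T) w := by rw [hQT]
      _ ≤ L1 M 5 G (coloops M G ∪ T) * (1 - fS M 5 G (coloops M G ∪ T)) := sum_faceLoss_le_L1_mul hG hd' _
      _ ≤ max 0 (L1 M 5 G (coloops M G ∪ T) - capS M 5 G (coloops M G ∪ T)) := L1_mul_one_sub_fS_le hcap
      _ ≤ max 0 (typeBound (G \ coloops M G).card ((G \ coloops M G) \ ℓ).card (T ∩ ℓ).card a₀ b₀ a₁ b₁) := by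
          apply max_le hmax0
          apply le_max_of_le_right
          unfold typeBound
          rw [hΦ] at hL1 ⊢
          nlinarith [hsum, hL1, hcap5]
  · have hzero : ∀ w ∈ T, faceLoss M 5 G (coloops M G ∪ T) w = 0 := by
      intro w hw
      unfold faceLoss
      rw [if_neg]
      rintro ⟨hthin, hwc⟩
      apply hQ
      have := insert_mem_shadowAt_thin hG hthin hwc
      rwa [Finset.insert_erase (Finset.mem_union_right _ hw)] at this
    rw [Finset.sum_eq_zero hzero]
    exact hmax0

end TypeLoss

section Eleven

variable {G : Finset α}

omit [DecidableEq α] [M.Finite] in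
/-- The chord of the convex function `1/(m + 3)` between `lo` and `hi`. -/
theorem one_div_le_chord_line (lo hi : ℚ) (hlo : 0 ≤ lo) (m : ℚ) (hlm : lo ≤ m) (hmh : m ≤ hi) :
    1 / (m + 3) ≤ (hi + lo + 3) / ((lo + 3) * (hi + 3)) - 1 / ((lo + 3) * (hi + 3)) * m := by
  have hhi : 0 ≤ hi := by linarith
  have hpos : 0 < (lo + 3) * (hi + 3) := by positivity
  have hm : 0 < m + 3 := by linarith
  have key : (hi + lo + 3) / ((lo + 3) * (hi + 3)) - 1 / ((lo + 3) * (hi + 3)) * m =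
      (hi + lo + 3 - m) / ((lo + 3) * (hi + 3)) := by ring
  rw [key, div_le_div_iff₀ hm hpos]
  nlinarith [mul_nonneg (sub_nonneg.2 hlm) (sub_nonneg.2 hmh)]

/-- The type constants at `n = 11`: the loss bound of a covering basis with `t` points on the line, `y = |V ∖ ℓ|`
(`t = 1`: `103/660`, `337/1980`, `31/165`, `139/660`; `t = 0`: `1/6`, `1081/5940`, `177/880`, `149/660` for
`y = 3, 4, 5, 6`). -/
def typeConst (t y : ℕ) : ℚ :=
  if t = 1 then (if y = 3 then 103 / 660 else if y = 4 then 337 / 1980 else if y = 5 then 31 / 165 else 139 / 660)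
  else (if y = 3 then 1 / 6 else if y = 4 then 1081 / 5940 else if y = 5 then 177 / 880 else 149 / 660)

omit [DecidableEq α] [M.Finite] in
/-- The constants are nonnegative. -/
theorem typeConst_nonneg (t y : ℕ) : 0 ≤ typeConst t y := by
  unfold typeConst; split_ifs <;> norm_num

open scoped Classical in
/-- **THE PER-BASIS LOSS BOUND AT `|V| = 11` BY TYPE**: a covering basis with `t ≤ 1` points on the common line loses
at most `typeConst t y`. -/
theorem faceLoss_sum_le_eleven (hG : G ∈ flatsQ M (5 + 1)) (hd : (gr M \ G).card = 3) (hk : kColoops M G = 2)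
    (hs : ∀ e ∈ gr M, ∀ f ∈ gr M, e ≠ f → rkN M {e, f} = 2) (hl : ∀ e ∈ gr M, M.Indep {e})
    (h11 : (G \ coloops M G).card = 11)
    {ℓ : Finset α} (hℓr : rkN M ℓ ≤ 2) (hℓ2 : 2 ≤ ℓ.card) (hℓV : ℓ ⊆ G \ coloops M G)
    (hℓcl : ∀ x ∈ G \ coloops M G, x ∈ clF M ℓ → x ∈ ℓ)
    (hy3 : 3 ≤ ((G \ coloops M G) \ ℓ).card) (hy6 : ((G \ coloops M G) \ ℓ).card ≤ 6)
    {S T : Finset α} (hT : T ∈ coverBases M G S 4) (ht : (T ∩ ℓ).card ≤ 1) :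
    ∑ w ∈ T, faceLoss M 5 G (coloops M G ∪ T) w ≤ typeConst (T ∩ ℓ).card ((G \ coloops M G) \ ℓ).card := by
  set y := ((G \ coloops M G) \ ℓ).card with hy
  set t := (T ∩ ℓ).card with htdef
  have hlo : (0 : ℚ) ≤ ((10 - y : ℕ) : ℚ) := by positivity
  have hmain := faceLoss_sum_le_of_line hG hd hk hs hl hℓr hℓ2 hℓV hℓcl hT ht
    (a₀ := ((8 : ℚ) + 2 + 3) / ((2 + 3) * (8 + 3))) (b₀ := 1 / ((2 + 3) * (8 + 3)))
    (a₁ := ((8 : ℚ) + ((10 - y : ℕ) : ℚ) + 3) / ((((10 - y : ℕ) : ℚ) + 3) * (8 + 3)))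
    (b₁ := 1 / ((((10 - y : ℕ) : ℚ) + 3) * (8 + 3)))
    (by
      have h4 : (4 : ℚ) ≤ ((10 - y : ℕ) : ℚ) := by
        have : 4 ≤ 10 - y := by omega
        exact_mod_cast this
      rw [div_le_div_iff₀ (by positivity) (by positivity)]
      nlinarith)
    (by positivity)
    (by
      intro m hm2 hm
      rw [h11] at hm
      have h8 : (m : ℚ) ≤ 8 := by exact_mod_cast (by omega : m ≤ 8)
      exact one_div_le_chord_line 2 8 (by norm_num) m (by exact_mod_cast hm2) h8)
    (by
      intro m _ hlom hm
      rw [h11] at hm hlom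
      have h8 : (m : ℚ) ≤ 8 := by exact_mod_cast (by omega : m ≤ 8)
      have hlo' : ((10 - y : ℕ) : ℚ) ≤ (m : ℚ) := by exact_mod_cast (by omega : 10 - y ≤ m)
      exact one_div_le_chord_line _ 8 hlo m hlo' h8)
  refine hmain.trans ?_
  rw [← hy, ← htdef, h11]
  have ht1 : t ≤ 1 := ht
  interval_cases y <;> interval_cases t <;>
    (unfold typeBound typeConst phiQ; norm_num)

end Eleven

end PercRepro.Shadow
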